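import Mathlib
import Summits.Ventures.FusionMHD.Models.CerfonFreidbergIterLikeQHalfMercDefs
import HarnessLib

/-!
# Ventures/FusionMHD — Models/CerfonFreidbergIterLikeQHalfMercPanels1.lean: KERNEL CHECK of the Mercier-register certificates of panel(s) 0 (of 32)
# at `ψ_N = 1/2` of THE Cerfon–Freidberg ITER-like instance

HONEST FRAMING (LADDER-GRIDFUSION three columns; CF rung; «F2.R2-CF-MERCIER-IMPLICIT» step (2), F2-SCOPING v1.6 §10(c)).  One `decide +kernel` (≈ 70 s): for each
listed panel the obligation `CFIterLike.QHalfMerc.MercCert.ok` (`Models/CerfonFreidbergIterLikeQHalfMercDefs.lean`) — the Taylor-model run of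
`progM = progA ++ block1 ++ block2 ++ block3M` over ★ #117's parameter box is ACCEPTED (both `inv` certificates included) and the kernel's FOUR panel-integral
enclosures (`g_W`, `g_Aσ`, `g_AR`, `g_B1` along the approximant) lie inside the claimed integers (read off a compiled `#eval` of the same functions, slack one unit of
`2⁻⁶⁰`; float truth inside every panel, `HOME/models/model-7/g7/genqm/truthM.json`).  MODELLED: analytic Cerfon–Freidberg family; nothing about a device or
stability.  No `native_decide`.  Typer/prover: gridfusion-model-7 (g7), 2026-08-27.
Citations: Jardin 2010 §8.5 (8.134) [Jardin2010]; Mahboubi–Melquiond–Sibut-Pinote 2016 §3.2 Lemma 3 [MahboubiMelquiondSibutpinote2016].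
-/

namespace Summit.Ventures.FusionMHD.Models.CFIterLike.QHalfMerc

/-- Mercier-register certificate data of panel(s) 0. [instance data] -/
def mercCert1 : List MercCert := [
  { j := 0, cand1 := [94661745770447339520, 20300713460575428608, 652310595854434566144, 172326083280062447616, 2781981305684470267904, 953911900309397700608, 10304997718563481452544, 3206462384168009990144, 167033857388417669660672, 3532239230908900036313088, -320090681416286845567762432, -4697942099670322203531935744, 246429299941212217602356543488],
    cand2 := [117796729607164919808, 14561371349909327872, 467816733149056139264, 118811589611231903744, 1919346440302088421376, 707253007985819123712, 7652581566071340793856, 3188473547041492959232, 60789689875603155582976, 825948198258458222395392, 54461630361096077745061888, -1843279648690889524108066816, -309160828520355354527137792000],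
    deg := 12, e1 := 42, e2 := 42, wlo := -227125001251454367, whi := -227124863906371308, slo := 3587007389148754852, shi := 3587007693867998461,
    rlo := 5561028661388054803, rhi := 5561029147955523848, blo := 2313712707973137853, bhi := 2313712898836130576 }]

/-- **KERNEL CHECK** of the four Mercier registers on panel(s) 0. -/
theorem mercCert1_ok : CFIterLike.QHalfMerc.mercCert1.all MercCert.ok = true := by
  decide +kernel

end Summit.Ventures.FusionMHD.Models.CFIterLike.QHalfMerc
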